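import Summits.HodgeConjecture.HodgeConjecture.Cruxes.BlochSeedDiscOne.SeedCheckerSplitBlockLetterBundle
import Literature.AlgebraicGeometry.Modules.TensorUnitors
import Literature.AlgebraicGeometry.AbelianVarieties.PoincareSheafOfPrincipal
import Literature.AlgebraicGeometry.AbelianVarieties.StructureSheafSemiHomogeneous

/-!
line stmt-HodgeConjecture-18881 Cruxes/BlochSeedDiscOne/Lines/birth.lean 814a6a70c14e831a stub_rung_pad4_seedAt

# SeedCheckerSplitBlockPicZeroPin — v42.4 of the C5–C8 seed-checker typing spec (hsemireg-c5c8-1 g55, 2026-08-31; commission director-hodge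
# g33 R19.894): the DECORATION-TOLERANT ORIGIN PIN `originPicZeroLaw := decLaw picZero` (origin letters of their own cells, twisted by
# `Pic⁰(S⁴)`), its two acceptance tests (K1) ∕ (K2), the monotone ∕ antitone transports, and — as TREE VOCABULARY — the two hazard
# constructions they are tested on (zero-letter PADDING, RELABELLING).  ADDITIVE: a NEW file importing v42.3 (`SeedCheckerSplitBlockLetterBundle`,
# 845643cddb00db48, BUILT R19.890); no declaration of v41 ∕ v42.1 ∕ v42.2 ∕ v42.3 is touched or redeclared.

PROVENANCE (this file is a PORT, not new mathematics).  PART H = idea-crit-hsem-3 g24's memo-212 import bench `V42ZeroLettersImport.lean`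
(b439365fa01ee059, memo `v42-label-freedom.md` 0c6f6f554e24ce3f) §A.0–§A.3 and §A.5, byte-identical except for the namespace (`…SplitBlock.Critic` ↦
`…SplitBlock.Hazard`) plus memo-213 ∕ memo-214's two `Relabelling.*_of_fixed` lemmas; PART P ∕ PART D = hsem-3 g26's memo-214 bench
`Memo214OriginPinBench.lean` (2c33becc2d00230f, memo `origin-pin-x2.md` 991b8aa432048987) PART 2 §C ∕ §D, byte-identical except for the namespace
(`Critic` ↦ `SplitBlock`) and the closing block «instance of record, by name» (c5c8-1 g55).  hsem-3's bytes elaborated on the farm by import of the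
BUILT v42.3 (memo-214 §5); c5c8-1 g55's HOME `g55/probe/LabelBench.lean` 4836f319673a0a77 carried (K1) `not_originLaw_padZero` and (K2′)
`relabel_trivial_of_originLaw` at the origin pin (director R19.894: «(K2′) ×2 PASS BY KERNEL»).

WHAT IS TYPED ∕ PROVED (sorry-free, standard axioms):

PART H — HAZARD CONSTRUCTIONS over the C-free datum of v42.1 (namespace `…SplitBlock.Hazard`):
  * (f6) ZERO-LETTER PADDING: `zeroKit`, `cutOffKit ∕ cutOffTerm` (a kit cut off its support: zero letters off `s`), `padZeroTerm` (the SAME module `𝓝`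
    re-split over `s ∪ X` with zero letters on the fresh cells `X` and ANY multiplicities there), `padDesign`, `Padding D` (fresh `XN ∕ XP` disjoint from
    the supports, extended multiplicities), `padZeroCore ∕ padZero δ p` (same kit, frame, block `S`, frame `S'`, section, subscheme; shell = the padded
    design), `padZero_passes_iff ∕ passes_padZero` (`Passes` is json of the padded CLASS design: C0 and `μ`), `letterHomVanishing₀_padZero`;
  * RELABELLING: `relabelL ∕ relabelTerm` (letters travel along a bijection `σ : s' ≃ s`), `Relabelling D` (new design `D'`, bijections `σP ∕ σN` of the
    supports, matched multiplicities), `relabelCore ∕ relabel δ r`, `relabel_Dsh`, `passes_relabel`, `relabel_termP_L ∕ relabel_termN_L` (the letter on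
    `Z'` IS the original letter of `σ Z'`), and the design combinatorics `Relabelling.eq_of_fixed ∕ Relabelling.shadow_eq_of_fixed` (a relabelling
    that moves no cell has the same supports, multiplicities and SHADOW).
PART P — (K2′) FOR ANY PINNING (`SplitBlockCore₀.PinnedTo ℓ` of v42.3) to a SEPARATING letter model: a relabelling pinned before and after FIXES
  EVERY CELL (`σP_fixed_of_pinned ∕ σN_fixed_of_pinned`), hence same supports and multiplicities (`relabel_trivial_of_pinned`) and THE SAME SHADOW
  (`shadow_relabel_eq_of_pinned`); at the origin pin of record modulo v42.3's `OriginSeparating`: `relabel_trivial_of_originLaw_x2`,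
  `shadow_relabel_eq_of_originLaw`, `rows_relabel_iff_of_originLaw` (NO row predicate tells an origin-pinned relabelling from the datum),
  `not_originLaw_relabel_of_moves` (a relabelling that moves one cell is not origin-pinned).
PART D — THE DECORATION-TOLERANT PIN (hazard (f7) of memo-214, ruling (P″)∕(R-a) R19.894):
  * `DecorationClass E₀` (a family of rank-one modules on `S⁴` containing `𝒪` — a structure of HYPOTHESES), the class of record `picZero E₀`
    (`HasRank Q 1 ∧ AbelianVarieties.IsHomogeneous (pad4Anchor E₀) Q` — Mukai's homogeneity `t_x^* Q ≅ Q`, i.e. `Pic⁰` for line bundles; `𝒪 ∈ picZero`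
    by the tree's `hasRank_unitModule` + `isHomogeneous_unit`), `DecPinnedTo 𝒟 δ ℓ` (every letter `≅ ℓ.bundle (its own cell) ⊗ Q`, `Q ∈ 𝒟`),
    `decPinnedTo_of_pinnedTo` (twist by `𝒪`, right unitor), `DecPinnedTo.lettersRankOne ∕ not_isZero_P ∕ not_isZero_N`;
  * the typed price `DecSeparating ℓ 𝒟` (twisted letters of distinct cells are not isomorphic) with `DecSeparating.separating : … → ℓ.Separating`, and at the
    law of record `OriginDecSeparating` (origin letters separated modulo `Pic⁰(S⁴)` on every CM anchor) with `OriginDecSeparating.originSeparating`;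
  * the laws: `DecorationClasses`, `decLaw 𝒟 : DatumLaw`, **`originPicZeroLaw := decLaw picZero`**, `originPicZeroLaw_iff`; MONOTONE `decLaw_of_originLaw`,
    **`originPicZeroLaw_of_originLaw`**; `rankOneLaw_of_decLaw ∕ rankOneLaw_of_originPicZeroLaw` (R1 survives);
  * (K1) OUTRIGHT: `not_decPinnedTo_padZero`, **`not_decLaw_padZero`**, `not_originPicZeroLaw_padZero` — a zero-letter padding with one fresh cell satisfies
    the decorated pin for NO decoration class;
  * (K2) MODULO DECORATED SEPARATION: `DecPinnedTo.cell_eq_P ∕ cell_eq_N`, `σP_fixed_of_decPinned ∕ σN_fixed_of_decPinned`, `shadow_relabel_eq_of_decPinned`,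
    **`shadow_relabel_eq_of_decLaw`**, `shadow_relabel_eq_of_originPicZeroLaw`, `rows_relabel_iff_of_originPicZeroLaw`;
  * the REACH GAP as implications: `not_pinnedTo_of_twisted`, `not_originLaw_of_twisted` (one non-cancelling twisted letter fails the origin pin although
    cells, classes and shadow are unchanged), `decPinnedTo_of_forall_twisted`;
  * TRANSPORTS: existence side `rung2a₀Under_decLaw_of_originLaw`, `Rung2a₀PicZero h := Rung2a₀Under originPicZeroLaw h` with
    `rung2a₀PicZero_of_rung2a₀Origin ∕ rung2a₀_of_rung2a₀PicZero`; kill side (v42.1 `rung2b₀Under_antitone`) **`rung2b₀Under_originLaw_of_decLaw`**, and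
    inside the guards of record of line #2 (`Lines/splitblock.lean`: `lawSigma S := S ∧ originLaw ∧ lawKNI`, `lawNatural S := S ∧ originLaw ∧ lawFloor`,
    `lawPinned S := S ∧ originLaw`, literally these lambdas) **`rung2b₀Under_sigma_originLaw_of_decLaw`** (`S ∧ pin ∧ K`) and
    **`rung2b₀Under_and_originLaw_of_decLaw`** (`S ∧ pin`), with the `picZero` instances `…_of_originPicZeroLaw`: REPLACING `originLaw` BY `originPicZeroLaw`
    IN A GUARD GIVES THE STRONGER 2b₀ RECORD, which implies the record of record and is the only one whose kill bears on `Pic⁰`-decorated presentations;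
  * `ReachModDec 𝒟 h : Prop` — the open NORMALISATION modulo decorations (`Rung2a₀Under (decLaw 𝒟) h → Rung2a₀Under originLaw h`), a `def`, stated,
    NOT asserted, NOT a theorem (R19.894); `rung2a₀Under_decLaw_iff` only under it as a hypothesis.

(f7-4) — WHICH CLASSES THE Σ-H ∕ ext ROWS READ (director R19.894, one line, the typing owner's reading; details on the bus RESULT-5 of c5c8-1 g55): AS TYPED
(v42.1 `sigmaH`, `extPP ∕ PN ∕ NP ∕ NN`, `extBudgetRow`, `budgetClause`; `SigmaH.lean`) the rows are functions of the SHADOW (plus `rank` and the datum's own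
block sheaf in `extBudgetLaw ∕ kniLaw`) — decoration-blind by construction, so moving them to the guard `originPicZeroLaw` per (R-a) is type-safe and, by
`rung2b₀Under_originLaw_of_decLaw`, only STRENGTHENS the record.  Their PEN justification reads Néron–Severi classes at NON-DEGENERATE letter pairs
(Mumford's index theorem: `hⁱ(L_Z^∨ ⊗ L_{Z'} ⊗ Q)` for `Q ∈ Pic⁰` and a non-degenerate class depends on the class only) and ISO classes only at DEGENERATE
pairs (`idx = 3`, weighted `0` by `pairDim`) and on the diagonal (priced `28`∕copy), where a `Pic⁰`-twist can only LOWER cohomology towards the typed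
count (semicontinuity; `h^•(Q) = 0` for `Q ∈ Pic⁰ ∖ {𝒪}`): `sigmaH` is the E₁-CEILING over all decorations («Pic⁰-separated atoms» convention of
`SigmaH.lean`), attained by the undecorated presentation — so a cell-dependent `Pic⁰` twist never breaks a Σ-H ∕ ext-COUNT row; decoration
sensitivity sits only in the pen of the LAW `kniLaw` (a hypothesis, not a row).

HONEST REGISTER.  Typed ≠ inhabited; registered ≠ closed.  `DecorationClass`, `picZero`, `DecPinnedTo`, `DecSeparating`, `OriginDecSeparating`, `decLaw`,
`originPicZeroLaw`, `Rung2a₀PicZero`, `ReachModDec` are `Prop`s ∕ shapes ∕ bundles of hypotheses — stated, never asserted; `OriginDecSeparating` (like v42.3's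
`OriginSeparating`) is documented TRUE (the Néron–Severi Gram sentence read in `NS = Pic ∕ Pic⁰`) and NOT proved here; every theorem is an implication,
an unfolding, or a statement about the two hazard constructions.  No datum, seed, sheaf or decorated presentation is constructed or asserted to exist.
Nothing here proves or refutes `stub_rung2a`, `Rung2a₀ 14`, `Rung2a₀Origin 14`, any row stub, `BlochSeedDiscOne` (stmt-18881), 18880, 30548, 19780,
27388, № 4, H2, HC_AV, HC_CM or HC.  No `sorry`, no new axiom, no `instance`, no notation, no `native_decide`.
-/

set_option linter.dupNamespace false
set_option autoImplicit false

open CategoryTheory AlgebraicGeometry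
open Literature.AlgebraicGeometry Literature.AlgebraicGeometry.Motives Literature.AlgebraicGeometry.HodgeTheory
open Literature.AlgebraicTopology.SingularHomology

noncomputable section

namespace Summit.HodgeConjecture.HodgeConjecture.Cruxes.BlochSeedDiscOne.SeedChecker

open Summit.HodgeConjecture.HodgeConjecture.Cruxes.BlochSeedDiscOne.Anchor
open Summit.Ventures.HSemireg Summit.Ventures.HSemireg.Pad4Tower
open CategoryTheory.Limits
open ZeroObject

namespace SplitBlock

/-! # PART H — THE TWO HAZARD CONSTRUCTIONS on the C-free datum (memo-212 §A.0–§A.3, §A.5, idea-crit-hsem-3 g24; namespace `Hazard`)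

(f6) LABEL FREEDOM of v42.1's C-free datum: `LetterKit₀.rankLEOne : HasRankLE (L Z) 1` admits the ZERO module and no field ties the letter `L Z` to the
cell `Z`; hence (i) zero letters may be PADDED onto fresh cells (`padZero`) and (ii) honest letters may be MOVED along any multiplicity-matching bijection of
cells (`relabel`) — same kit, frame, block, frame sequence, section, subscheme; `Passes` transfers as soon as the new CLASS design keeps C0 and `μ`.  These are
the objects the pins of v42.3 (`originLaw`) and of PART D (`decLaw`) are acceptance-tested on ((K1): kill (i) outright; (K2): kill (ii) modulo separation). -/

namespace Hazard

/-! ## §A.0 three conjugation lemmas over variable objects (so that `subst` is available) -/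

section EqToHom

variable {𝒞 : Type*} [CategoryTheory.Category 𝒞]

theorem conj_eqToHom_eq_id {X Y W : 𝒞} (e : X = Y) (f : Y ⟶ W) (g : W ⟶ Y) (h : f ≫ g = 𝟙 Y) :
    (eqToHom e ≫ f) ≫ (g ≫ eqToHom e.symm) = 𝟙 X := by
  subst e
  simpa using h

theorem conj_eqToHom_eq_zero [HasZeroMorphisms 𝒞] {X Y X' Y' W : 𝒞} (e : X = Y) (e' : X' = Y') (f : Y ⟶ W) (g : W ⟶ Y') (h : f ≫ g = 0) :
    (eqToHom e ≫ f) ≫ (g ≫ eqToHom e'.symm) = 0 := by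
  subst e
  subst e'
  simpa using h

theorem conj_eqToHom_cancel {X Y W : 𝒞} (e : X = Y) (g : W ⟶ Y) (f : Y ⟶ W) :
    (g ≫ eqToHom e.symm) ≫ (eqToHom e ≫ f) = g ≫ f := by
  subst e
  simp

theorem conj_eqToHom_of_forall_eq_zero [HasZeroMorphisms 𝒞] {X Y X' Y' : 𝒞} (e : X = Y) (e' : X' = Y') (h : ∀ f : Y ⟶ Y', f = 0) (f : X ⟶ X') :
    f = 0 := by
  subst e
  subst e'
  exact h f

end EqToHom

variable {E₀ : AbelianVariety ℂ} {ψ₀ : E₀ ⟶ E₀}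

/-! ## §A.1 the zero module is an admissible letter; cutting a kit off its support -/

/-- (f6-0) **the ZERO module is a letter**: `HasRankLE M 1` for `M` zero. -/
theorem hasRankLE_one_of_isZero {M : (pad4Anchor E₀).X.left.Modules} (hM : IsZero M) : HasRankLE M 1 :=
  (hasRankLE_zero_of_isZero hM).mono zero_le_one

/-- (f6-1) the all-zero letter kit on ANY finite set of cells. -/
def zeroKit (E₀ : AbelianVariety ℂ) (s : Finset MCell) : LetterKit₀ E₀ s :=
  ⟨fun _ => 0, fun _ _ => hasRankLE_one_of_isZero (isZero_zero _)⟩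

variable {s : Finset MCell} {m : MCell → ℤ} {𝓝 : (pad4Anchor E₀).X.left.Modules}

/-- (f6-2) a kit CUT OFF its support: the same letters on `s`, the zero module off `s`. -/
def cutOffKit (k : LetterKit₀ E₀ s) : LetterKit₀ E₀ s where
  L Z := if Z ∈ s then k.L Z else 0
  rankLEOne Z hZ := by
    show HasRankLE (if Z ∈ s then k.L Z else 0) 1
    rw [if_pos hZ]
    exact k.rankLEOne Z hZ

theorem cutOffKit_L_of_mem (k : LetterKit₀ E₀ s) {Z : MCell} (hZ : Z ∈ s) : (cutOffKit k).L Z = k.L Z :=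
  if_pos hZ

theorem isZero_cutOffKit_L (k : LetterKit₀ E₀ s) {Z : MCell} (hZ : Z ∉ s) : IsZero ((cutOffKit k).L Z) := by
  show IsZero (if Z ∈ s then k.L Z else 0)
  rw [if_neg hZ]
  exact isZero_zero _

/-- (f6-3) the same split term over the cut-off kit (entries conjugated by the `eqToHom`s of `cutOffKit_L_of_mem`). -/
def cutOffTerm (T : BlockTerm₀ E₀ s m 𝓝) : BlockTerm₀ E₀ s m 𝓝 where
  kit := cutOffKit T.kit
  inj Z c := eqToHom (cutOffKit_L_of_mem T.kit Z.2) ≫ T.inj Z c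
  proj Z c := T.proj Z c ≫ eqToHom (cutOffKit_L_of_mem T.kit Z.2).symm
  proj_inj_self Z c := conj_eqToHom_eq_id (cutOffKit_L_of_mem T.kit Z.2) _ _ (T.proj_inj_self Z c)
  proj_inj_ne Z c Z' c' h :=
    conj_eqToHom_eq_zero (cutOffKit_L_of_mem T.kit Z.2) (cutOffKit_L_of_mem T.kit Z'.2) _ _ (T.proj_inj_ne Z c Z' c' h)
  total := by
    simp only [conj_eqToHom_cancel]
    exact T.total

theorem isZero_cutOffTerm_L (T : BlockTerm₀ E₀ s m 𝓝) {Z : MCell} (hZ : Z ∉ s) : IsZero ((cutOffTerm T).kit.L Z) :=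
  isZero_cutOffKit_L T.kit hZ

theorem cutOffTerm_L_of_mem (T : BlockTerm₀ E₀ s m 𝓝) {Z : MCell} (hZ : Z ∈ s) : (cutOffTerm T).kit.L Z = T.kit.L Z :=
  cutOffKit_L_of_mem T.kit hZ

/-! ## §A.2 ZERO-LETTER PADDING of a split term: fresh cells `X`, ANY multiplicities on them, the SAME module `𝓝` -/

/-- the old summand of the total on `s`, zero off `s`. -/
def padSummand (T : BlockTerm₀ E₀ s m 𝓝) (Z : MCell) : 𝓝 ⟶ 𝓝 :=
  if h : Z ∈ s then ∑ c : Fin (m Z).toNat, T.proj ⟨Z, h⟩ c ≫ T.inj ⟨Z, h⟩ c else 0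

theorem padSummand_of_mem (T : BlockTerm₀ E₀ s m 𝓝) {Z : MCell} (h : Z ∈ s) :
    padSummand T Z = ∑ c : Fin (m Z).toNat, T.proj ⟨Z, h⟩ c ≫ T.inj ⟨Z, h⟩ c :=
  dif_pos h

theorem padSummand_of_not_mem (T : BlockTerm₀ E₀ s m 𝓝) {Z : MCell} (h : Z ∉ s) : padSummand T Z = 0 :=
  dif_neg h

theorem sum_padSummand (T : BlockTerm₀ E₀ s m 𝓝) : ∑ Z ∈ s, padSummand T Z = 𝟙 𝓝 := by
  rw [← Finset.sum_coe_sort, ← T.total]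
  exact Fintype.sum_congr _ _ fun Z => padSummand_of_mem T Z.2

/-- (f6-4) **ZERO-LETTER PADDING of a split term.**  Given a split term on the cells `s` whose kit VANISHES on the fresh cells `X` (e.g. a cut-off
term), the SAME module `𝓝` is a split term on `s ∪ X` for ANY multiplicity function `m'` agreeing with `m` on `s`: the new injections ∕ projections
are zero, and the biproduct equations hold because the new letters are zero objects.  No sheaf changes. -/
def padZeroTerm (T : BlockTerm₀ E₀ s m 𝓝) (X : Finset MCell) (m' : MCell → ℤ) (hm : ∀ Z ∈ s, m' Z = m Z)
    (hX : ∀ Z ∈ X, IsZero (T.kit.L Z)) (hsX : Disjoint s X) : BlockTerm₀ E₀ (s ∪ X) m' 𝓝 where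
  kit := ⟨T.kit.L, fun Z hZ => (Finset.mem_union.1 hZ).elim (T.kit.rankLEOne Z) fun h => hasRankLE_one_of_isZero (hX Z h)⟩
  inj Z := if h : (Z : MCell) ∈ s then fun c => T.inj ⟨Z, h⟩ (c.cast (congrArg Int.toNat (hm Z h))) else fun _ => 0
  proj Z := if h : (Z : MCell) ∈ s then fun c => T.proj ⟨Z, h⟩ (c.cast (congrArg Int.toNat (hm Z h))) else fun _ => 0
  proj_inj_self Z c := by
    by_cases h : (Z : MCell) ∈ s
    · simp only [dif_pos h]
      exact T.proj_inj_self ⟨Z, h⟩ _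
    · exact (hX Z ((Finset.mem_union.1 Z.2).resolve_left h)).eq_of_src _ _
  proj_inj_ne Z c Z' c' hne := by
    by_cases h : (Z : MCell) ∈ s
    · by_cases h' : (Z' : MCell) ∈ s
      · simp only [dif_pos h, dif_pos h']
        refine T.proj_inj_ne ⟨Z, h⟩ _ ⟨Z', h'⟩ _ fun hEq => hne ?_
        obtain ⟨Z, hZ⟩ := Z
        obtain ⟨Z', hZ'⟩ := Z'
        obtain ⟨hZZ, hcc⟩ := Sigma.mk.inj_iff.1 hEq
        have hZZ' : Z = Z' := congrArg Subtype.val hZZ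
        subst hZZ'
        have hcc' : c = c' := Fin.cast_injective _ (eq_of_heq hcc)
        subst hcc'
        rfl
      · simp only [dif_pos h, dif_neg h', comp_zero]
    · simp only [dif_neg h, zero_comp]
  total := by
    refine (Fintype.sum_congr _ (fun Z : ↥(s ∪ X) => padSummand T (Z : MCell)) fun Z => ?_).trans ?_
    · by_cases h : (Z : MCell) ∈ s
      · rw [padSummand_of_mem T h]
        simp only [dif_pos h]
        exact Fintype.sum_equiv (finCongr (congrArg Int.toNat (hm Z h))) _ _ fun c => rfl
      · rw [padSummand_of_not_mem T h]
        simp only [dif_neg h, zero_comp, Finset.sum_const_zero]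
    · rw [Finset.sum_coe_sort (s ∪ X) (padSummand T), Finset.sum_union hsX,
        Finset.sum_eq_zero fun Z hZ => padSummand_of_not_mem T (Finset.disjoint_right.1 hsX hZ), add_zero, sum_padSummand]

/-- the padded term's letters are the old kit's letters (on `s`: the honest ones; on `X`: zero). [`rfl`] -/
theorem padZeroTerm_L (T : BlockTerm₀ E₀ s m 𝓝) (X : Finset MCell) (m' : MCell → ℤ) (hm : ∀ Z ∈ s, m' Z = m Z)
    (hX : ∀ Z ∈ X, IsZero (T.kit.L Z)) (hsX : Disjoint s X) (Z : MCell) : (padZeroTerm T X m' hm hX hsX).kit.L Z = T.kit.L Z :=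
  rfl

/-! ## §A.3 padding a DESIGN (json) and a C-free DATUM (same kit, frame, block, frame sequence, section, subscheme) -/

/-- the shell design padded by fresh `N`-cells `XN` and `P`-cells `XP`, with multiplicity functions `mN' ∕ mP'`. -/
def padDesign (D : Design) (XN XP : Finset MCell) (mN' mP' : MCell → ℤ) : Design :=
  ⟨⟨D.cfg.lower ∪ XN, D.cfg.upper ∪ XP⟩, mN', mP'⟩

@[simp] theorem padDesign_lower (D : Design) (XN XP : Finset MCell) (mN' mP' : MCell → ℤ) :
    (padDesign D XN XP mN' mP').cfg.lower = D.cfg.lower ∪ XN := rfl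
@[simp] theorem padDesign_upper (D : Design) (XN XP : Finset MCell) (mN' mP' : MCell → ℤ) :
    (padDesign D XN XP mN' mP').cfg.upper = D.cfg.upper ∪ XP := rfl
@[simp] theorem padDesign_mN (D : Design) (XN XP : Finset MCell) (mN' mP' : MCell → ℤ) : (padDesign D XN XP mN' mP').mN = mN' := rfl
@[simp] theorem padDesign_mP (D : Design) (XN XP : Finset MCell) (mN' mP' : MCell → ℤ) : (padDesign D XN XP mN' mP').mP = mP' := rfl

/-- **the padding data**: fresh cells and multiplicities extending the shell's. -/
structure Padding (D : Design) where
  XN : Finset MCell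
  XP : Finset MCell
  mN' : MCell → ℤ
  mP' : MCell → ℤ
  hmN : ∀ Z ∈ D.cfg.lower, mN' Z = D.mN Z
  hmP : ∀ Z ∈ D.cfg.upper, mP' Z = D.mP Z
  hN : Disjoint D.cfg.lower XN
  hP : Disjoint D.cfg.upper XP

/-- the padded design of a padding. -/
def Padding.design {D : Design} (p : Padding D) : Design := padDesign D p.XN p.XP p.mN' p.mP'

/-- (f6-5) **ZERO-LETTER PADDING OF A C-FREE CORE**: same anchor kit, word frame, links, block `S` (hence the same `𝓟`, `𝓝`, `𝓔`), the shell
design padded by fresh cells carrying ZERO letters. -/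
def padZeroCore (δ : SplitBlockCore₀ E₀ ψ₀) (p : Padding δ.Dsh) : SplitBlockCore₀ E₀ ψ₀ where
  K := δ.K
  Φ := δ.Φ
  links := δ.links
  Dsh := p.design
  S := δ.S
  shortExact := δ.shortExact
  isVectorBundle₁ := δ.isVectorBundle₁
  isVectorBundle₃ := δ.isVectorBundle₃
  termP := padZeroTerm (cutOffTerm δ.termP) p.XP p.mP' p.hmP (fun _ hZ => isZero_cutOffTerm_L δ.termP (Finset.disjoint_right.1 p.hP hZ)) p.hP
  termN := padZeroTerm (cutOffTerm δ.termN) p.XN p.mN' p.hmN (fun _ hZ => isZero_cutOffTerm_L δ.termN (Finset.disjoint_right.1 p.hN hZ)) p.hN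

/-- (f6-6) **ZERO-LETTER PADDING OF A C-FREE DATUM**: the padded core, the SAME `k`, frame sequence `S'`, `mid`, `frameIso`, rank-4 quotient,
section `s`, subscheme `Z`, immersion `i`. -/
def padZero (δ : SplitBlockDatum₀ E₀ ψ₀) (p : Padding δ.Dsh) : SplitBlockDatum₀ E₀ ψ₀ where
  toSplitBlockCore₀ := padZeroCore δ.toSplitBlockCore₀ p
  k := δ.k
  S' := δ.S'
  shortExact' := δ.shortExact'
  mid := δ.mid
  frameIso := δ.frameIso
  isVectorBundle₁' := δ.isVectorBundle₁'
  rank4 := δ.rank4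
  s := δ.s
  Z := δ.Z
  i := δ.i

variable (δ : SplitBlockDatum₀ E₀ ψ₀) (p : Padding δ.Dsh)

theorem padZero_Dsh : (padZero δ p).Dsh = p.design := rfl
theorem padZero_K : (padZero δ p).K = δ.K := rfl
theorem padZero_S : (padZero δ p).S = δ.S := rfl
theorem padZero_S' : (padZero δ p).S' = δ.S' := rfl
theorem padZero_i : (padZero δ p).i = δ.i := rfl
theorem padZero_classDesign : (padZero δ p).classDesign = p.design.padApexUp 0 δ.k := rfl

/-- **`Passes` OF THE PADDED DATUM IS DECIDED BY THE JSON of the padded class design plus the UNCHANGED kit ∕ subscheme ∕ section.** [`Iff.rfl`] -/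
theorem padZero_passes_iff :
    (padZero δ p).Passes ↔ (∃ q : ℚ, (p.design.padApexUp 0 δ.k).SeedCheck δ.K δ.i q) ∧ IsZeroSchemeOf δ.s δ.i :=
  Iff.rfl

/-- **a PASSING datum stays PASSING after any zero-letter padding that keeps C0 and `μ` of the class design** (both json). -/
theorem passes_padZero (h : δ.Passes) (hC0 : (p.design.padApexUp 0 δ.k).ClassData)
    (hμ : (p.design.padApexUp 0 δ.k).mu = δ.classDesign.mu) : (padZero δ p).Passes := by
  obtain ⟨⟨q, hq⟩, hz⟩ := h
  refine ⟨⟨q, hC0, hq.2.1, hq.2.2.1, hq.2.2.2.1, hq.2.2.2.2.1, hq.2.2.2.2.2.1, ?_⟩, hz⟩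
  have e : (padZero δ p).classDesign.mu = δ.classDesign.mu := hμ
  rw [e]
  exact hq.2.2.2.2.2.2

/-- **the C-free letter law `LetterHomVanishing₀` is LABEL-BLIND**: it transfers to every zero-letter padding (`Hom(0, –) = Hom(–, 0) = 0`). -/
theorem letterHomVanishing₀_padZero (h : δ.toSplitBlockCore₀.LetterHomVanishing₀) :
    (padZero δ p).toSplitBlockCore₀.LetterHomVanishing₀ := by
  intro P N hw f
  by_cases hP : (P : MCell) ∈ δ.Dsh.cfg.upper
  · by_cases hN : (N : MCell) ∈ δ.Dsh.cfg.lower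
    · exact conj_eqToHom_of_forall_eq_zero (cutOffTerm_L_of_mem δ.termP hP) (cutOffTerm_L_of_mem δ.termN hN) (h ⟨P, hP⟩ ⟨N, hN⟩ hw) f
    · exact (isZero_cutOffTerm_L δ.termN hN).eq_of_tgt _ _
  · exact (isZero_cutOffTerm_L δ.termP hP).eq_of_src _ _


/-! ## §A.5 RELABELLING (survives the cheap repair «letters of rank EXACTLY 1»): honest letters, ARBITRARY cells

Even with honest letters the CELLS are free: a split term on `s` is a split term on ANY `s'` in bijection with `s` under matched multiplicities,
the letters travelling with the bijection.  Hence a datum's `Passes` sees of the shell only `(C0, μ)` of the class design and the multiplicity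
PROFILE; a guarded 2b₀ then forces `Rows` on every clean positive in-scope relabelling with the same `μ` — unless the law `Λ` PINS LABELS
(a Hom-vanishing pattern indexed by `WeakLive` on the cells, like `LetterHomVanishing₀`, is label-SENSITIVE for honest letters: that is repair R2). -/

/-- the relabelled letter function: the letter of `σ Z'` sits on `Z'`; zero off `s'`. -/
def relabelL (T : BlockTerm₀ E₀ s m 𝓝) (s' : Finset MCell) (σ : ↥s' ≃ ↥s) (Z' : MCell) : (pad4Anchor E₀).X.left.Modules :=
  if h : Z' ∈ s' then T.kit.L (σ ⟨Z', h⟩) else 0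

theorem relabelL_of_mem (T : BlockTerm₀ E₀ s m 𝓝) (s' : Finset MCell) (σ : ↥s' ≃ ↥s) {Z' : MCell} (h : Z' ∈ s') :
    relabelL T s' σ Z' = T.kit.L (σ ⟨Z', h⟩) :=
  dif_pos h

theorem relabelL_coe (T : BlockTerm₀ E₀ s m 𝓝) (s' : Finset MCell) (σ : ↥s' ≃ ↥s) (Z' : ↥s') :
    relabelL T s' σ Z' = T.kit.L (σ Z') := by
  rw [relabelL_of_mem T s' σ Z'.2]

/-- (f6-7) **RELABELLED split term**: same module `𝓝`, same letters, cells replaced along ANY multiplicity-matching bijection `σ : s' ≃ s`. -/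
def relabelTerm (T : BlockTerm₀ E₀ s m 𝓝) (s' : Finset MCell) (m' : MCell → ℤ) (σ : ↥s' ≃ ↥s)
    (hm : ∀ Z' : ↥s', m' Z' = m (σ Z')) : BlockTerm₀ E₀ s' m' 𝓝 where
  kit := ⟨relabelL T s' σ, fun Z' hZ' => by
    rw [relabelL_of_mem T s' σ hZ']
    exact T.kit.rankLEOne _ (σ ⟨Z', hZ'⟩).2⟩
  inj Z' c := eqToHom (relabelL_coe T s' σ Z') ≫ T.inj (σ Z') (c.cast (congrArg Int.toNat (hm Z')))
  proj Z' c := T.proj (σ Z') (c.cast (congrArg Int.toNat (hm Z'))) ≫ eqToHom (relabelL_coe T s' σ Z').symm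
  proj_inj_self Z' c := conj_eqToHom_eq_id (relabelL_coe T s' σ Z') _ _ (T.proj_inj_self (σ Z') _)
  proj_inj_ne Z c Z' c' hne :=
    conj_eqToHom_eq_zero (relabelL_coe T s' σ Z) (relabelL_coe T s' σ Z') _ _
      (T.proj_inj_ne (σ Z) _ (σ Z') _ fun hEq => hne (by
        obtain ⟨h1, h2⟩ := Sigma.mk.inj_iff.1 hEq
        have hZZ : Z = Z' := σ.injective h1
        subst hZZ
        have hcc : c = c' := Fin.cast_injective _ (eq_of_heq h2)
        subst hcc
        rfl))
  total := by
    simp only [conj_eqToHom_cancel]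
    rw [← T.total]
    refine Fintype.sum_equiv σ _ _ fun Z' => ?_
    exact Fintype.sum_equiv (finCongr (congrArg Int.toNat (hm Z'))) _ _ fun c => rfl

/-- **relabelling data for a shell design**: a new design with multiplicity-matching bijections of supports, side by side. -/
structure Relabelling (D : Design) where
  D' : Design
  σN : ↥D'.cfg.lower ≃ ↥D.cfg.lower
  σP : ↥D'.cfg.upper ≃ ↥D.cfg.upper
  hmN : ∀ Z' : ↥D'.cfg.lower, D'.mN Z' = D.mN (σN Z')
  hmP : ∀ Z' : ↥D'.cfg.upper, D'.mP Z' = D.mP (σP Z')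

/-- (f6-8) **RELABELLED C-free core ∕ datum**: everything as in `δ` except the shell design and the cells the letters sit on. -/
def relabelCore (δ : SplitBlockCore₀ E₀ ψ₀) (r : Relabelling δ.Dsh) : SplitBlockCore₀ E₀ ψ₀ where
  K := δ.K
  Φ := δ.Φ
  links := δ.links
  Dsh := r.D'
  S := δ.S
  shortExact := δ.shortExact
  isVectorBundle₁ := δ.isVectorBundle₁
  isVectorBundle₃ := δ.isVectorBundle₃
  termP := relabelTerm δ.termP r.D'.cfg.upper r.D'.mP r.σP r.hmP
  termN := relabelTerm δ.termN r.D'.cfg.lower r.D'.mN r.σN r.hmN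

def relabel (r : Relabelling δ.Dsh) : SplitBlockDatum₀ E₀ ψ₀ where
  toSplitBlockCore₀ := relabelCore δ.toSplitBlockCore₀ r
  k := δ.k
  S' := δ.S'
  shortExact' := δ.shortExact'
  mid := δ.mid
  frameIso := δ.frameIso
  isVectorBundle₁' := δ.isVectorBundle₁'
  rank4 := δ.rank4
  s := δ.s
  Z := δ.Z
  i := δ.i

theorem relabel_Dsh (r : Relabelling δ.Dsh) : (relabel δ r).Dsh = r.D' := rfl

/-- **`Passes` of a relabelled datum is json of the new class design** (C0 and `μ`), exactly as for paddings. -/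
theorem passes_relabel (r : Relabelling δ.Dsh) (h : δ.Passes) (hC0 : (r.D'.padApexUp 0 δ.k).ClassData)
    (hμ : (r.D'.padApexUp 0 δ.k).mu = δ.classDesign.mu) : (relabel δ r).Passes := by
  obtain ⟨⟨q, hq⟩, hz⟩ := h
  refine ⟨⟨q, hC0, hq.2.1, hq.2.2.1, hq.2.2.2.1, hq.2.2.2.2.1, hq.2.2.2.2.2.1, ?_⟩, hz⟩
  have e : (relabel δ r).classDesign.mu = δ.classDesign.mu := hμ
  rw [e]
  exact hq.2.2.2.2.2.2


section RelabelLetters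

variable (r : Relabelling δ.Dsh)


/-- the relabelled datum carries on the `P`-cell `Z'` the ORIGINAL letter of `σP Z'`, on the nose (memo-212 `relabelL_coe`). -/
theorem relabel_termP_L (Z' : ↥r.D'.cfg.upper) : (relabel δ r).termP.kit.L Z' = δ.termP.kit.L (r.σP Z') :=
  relabelL_coe δ.termP r.D'.cfg.upper r.σP Z'

/-- … and on the `N`-cell `Z'` the original letter of `σN Z'`. -/
theorem relabel_termN_L (Z' : ↥r.D'.cfg.lower) : (relabel δ r).termN.kit.L Z' = δ.termN.kit.L (r.σN Z') :=
  relabelL_coe δ.termN r.D'.cfg.lower r.σN Z'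


end RelabelLetters


/-- a relabelling that moves nothing changes nothing: same supports, same multiplicities … (memo-213 §B.4, verbatim) -/
theorem Relabelling.eq_of_fixed {D : Design} (r : Relabelling D) (hP : ∀ Z' : ↥r.D'.cfg.upper, (r.σP Z' : MCell) = Z')
    (hN : ∀ Z' : ↥r.D'.cfg.lower, (r.σN Z' : MCell) = Z') :
    r.D'.cfg.upper = D.cfg.upper ∧ r.D'.cfg.lower = D.cfg.lower ∧
      (∀ Z ∈ r.D'.cfg.upper, r.D'.mP Z = D.mP Z) ∧ (∀ Z ∈ r.D'.cfg.lower, r.D'.mN Z = D.mN Z) := by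
  refine ⟨?_, ?_, fun Z hZ => (r.hmP ⟨Z, hZ⟩).trans (by rw [hP ⟨Z, hZ⟩]), fun Z hZ => (r.hmN ⟨Z, hZ⟩).trans (by rw [hN ⟨Z, hZ⟩])⟩
  · apply Finset.eq_of_subset_of_card_le
    · intro Z hZ
      have hm := (r.σP ⟨Z, hZ⟩).2
      rwa [hP ⟨Z, hZ⟩] at hm
    · rw [← Fintype.card_coe r.D'.cfg.upper, ← Fintype.card_coe D.cfg.upper, Fintype.card_congr r.σP]
  · apply Finset.eq_of_subset_of_card_le
    · intro Z hZ
      have hm := (r.σN ⟨Z, hZ⟩).2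
      rwa [hN ⟨Z, hZ⟩] at hm
    · rw [← Fintype.card_coe r.D'.cfg.lower, ← Fintype.card_coe D.cfg.lower, Fintype.card_congr r.σN]

/-- … hence the same SHADOW (the letter design the rows read). (memo-213 §B.4, verbatim) -/
theorem Relabelling.shadow_eq_of_fixed {D : Design} (r : Relabelling D) (hP : ∀ Z' : ↥r.D'.cfg.upper, (r.σP Z' : MCell) = Z')
    (hN : ∀ Z' : ↥r.D'.cfg.lower, (r.σN Z' : MCell) = Z') : r.D'.shadow = D.shadow := by
  obtain ⟨hU, hL, hmP, hmN⟩ := r.eq_of_fixed hP hN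
  have h1 : r.D'.cfg.lower.toList.map (fun Z => (shadowCell Z, (r.D'.mN Z).toNat)) = D.cfg.lower.toList.map (fun Z => (shadowCell Z, (D.mN Z).toNat)) := by
    rw [hL]
    exact List.map_congr_left fun Z hZ => by rw [hmN Z (hL ▸ Finset.mem_toList.1 hZ)]
  have h2 : r.D'.cfg.upper.toList.map (fun P => (shadowCell P, (r.D'.mP P).toNat)) = D.cfg.upper.toList.map (fun P => (shadowCell P, (D.mP P).toNat)) := by
    rw [hU]
    exact List.map_congr_left fun Z hZ => by rw [hmP Z (hU ▸ Finset.mem_toList.1 hZ)]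
  unfold Design.shadow
  rw [h1, h2]


end Hazard

open Hazard
open Literature.AlgebraicGeometry.Modules

variable {E₀ : AbelianVariety ℂ} {ψ₀ : E₀ ⟶ E₀}

/-! # PART P — (K2′) FOR ANY PINNING TO A SEPARATING LETTER MODEL: a pinned relabelling of a pinned datum moves no cell and has the same shadow
(memo-214 §C, idea-crit-hsem-3 g26 — the ×2 of c5c8-1 g55's `relabel_trivial_of_originLaw`, pushed to the statement the rows read) -/

section PinnedRelabel

variable {δ : SplitBlockDatum₀ E₀ ψ₀} {r : Relabelling δ.Dsh} {ℓ : LetterModel E₀}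



/-- **(K2′)(i) ×2 — pinned to a SEPARATING model before and after, a relabelling FIXES EVERY `P`-CELL**: the letter on `Z'` is `≅ ℓ.bundle Z'`
(pinned after) and IS the letter of `σP Z'`, itself `≅ ℓ.bundle (σP Z')` (pinned before); separation.
[tree v42.3 `LetterModel.Separating`, `SplitBlockCore₀.PinnedTo`; memo-212 `relabelL_coe`] -/
theorem σP_fixed_of_pinned (hs : ℓ.Separating) (h : δ.PinnedTo ℓ) (h' : (relabel δ r).PinnedTo ℓ) (Z' : ↥r.D'.cfg.upper) :
    ((r.σP Z' : ↥δ.Dsh.cfg.upper) : MCell) = Z' := by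
  obtain ⟨i⟩ := h.1 (r.σP Z' : MCell) (r.σP Z').2
  obtain ⟨i'⟩ := h'.1 (Z' : MCell) Z'.2
  exact hs _ _ ⟨i.symm ≪≫ eqToIso (relabel_termP_L δ r Z').symm ≪≫ i'⟩

/-- **(K2′)(i) ×2, `N`-side.** -/
theorem σN_fixed_of_pinned (hs : ℓ.Separating) (h : δ.PinnedTo ℓ) (h' : (relabel δ r).PinnedTo ℓ) (Z' : ↥r.D'.cfg.lower) :
    ((r.σN Z' : ↥δ.Dsh.cfg.lower) : MCell) = Z' := by
  obtain ⟨i⟩ := h.2 (r.σN Z' : MCell) (r.σN Z').2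
  obtain ⟨i'⟩ := h'.2 (Z' : MCell) Z'.2
  exact hs _ _ ⟨i.symm ≪≫ eqToIso (relabel_termN_L δ r Z').symm ≪≫ i'⟩


/-- **(K2′)(ii) ×2** — pinned to a separating model before and after: same supports, same multiplicities ON the supports (c5c8-1 g55's
conclusion shape; off the supports a `Design`'s multiplicity functions are unconstrained, so `r.D' = δ.Dsh` itself is not claimed). -/
theorem relabel_trivial_of_pinned (hs : ℓ.Separating) (h : δ.PinnedTo ℓ) (h' : (relabel δ r).PinnedTo ℓ) :
    r.D'.cfg.upper = δ.Dsh.cfg.upper ∧ r.D'.cfg.lower = δ.Dsh.cfg.lower ∧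
      (∀ Z' : ↥r.D'.cfg.upper, r.D'.mP Z' = δ.Dsh.mP Z') ∧ (∀ Z' : ↥r.D'.cfg.lower, r.D'.mN Z' = δ.Dsh.mN Z') := by
  obtain ⟨hU, hL, hmP, hmN⟩ := r.eq_of_fixed (σP_fixed_of_pinned hs h h') (σN_fixed_of_pinned hs h h')
  exact ⟨hU, hL, fun Z' => hmP Z' Z'.2, fun Z' => hmN Z' Z'.2⟩

/-- **(K2′)(iii)** — what the rows read: THE SAME SHADOW. -/
theorem shadow_relabel_eq_of_pinned (hs : ℓ.Separating) (h : δ.PinnedTo ℓ) (h' : (relabel δ r).PinnedTo ℓ) :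
    (relabel δ r).Dsh.shadow = δ.Dsh.shadow :=
  r.shadow_eq_of_fixed (σP_fixed_of_pinned hs h h') (σN_fixed_of_pinned hs h h')

/-- **(K2′) AT THE LAW OF RECORD — c5c8-1 g55's statement verbatim, ×2 by import of tree v42.3.** -/
theorem relabel_trivial_of_originLaw_x2 (hsep : OriginSeparating) (hψ : ψ₀ ≫ ψ₀ = -(1 • 𝟙 E₀))
    (h : originLaw E₀ ψ₀ δ) (h' : originLaw E₀ ψ₀ (relabel δ r)) :
    r.D'.cfg.upper = δ.Dsh.cfg.upper ∧ r.D'.cfg.lower = δ.Dsh.cfg.lower ∧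
      (∀ Z' : ↥r.D'.cfg.upper, r.D'.mP Z' = δ.Dsh.mP Z') ∧ (∀ Z' : ↥r.D'.cfg.lower, r.D'.mN Z' = δ.Dsh.mN Z') :=
  relabel_trivial_of_pinned (hsep E₀ h.dim_eq_one ψ₀ hψ) h.pinnedTo ((originLaw_iff h.dim_eq_one _).1 h')

/-- **an origin-pinned relabelling of an origin-pinned datum has the same shadow.** -/
theorem shadow_relabel_eq_of_originLaw (hsep : OriginSeparating) (hψ : ψ₀ ≫ ψ₀ = -(1 • 𝟙 E₀)) (h : originLaw E₀ ψ₀ δ)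
    (h' : originLaw E₀ ψ₀ (relabel δ r)) : (relabel δ r).Dsh.shadow = δ.Dsh.shadow :=
  shadow_relabel_eq_of_pinned (hsep E₀ h.dim_eq_one ψ₀ hψ) h.pinnedTo ((originLaw_iff h.dim_eq_one _).1 h')

/-- hence NO row predicate tells an origin-pinned relabelling from the datum: the relabelling critic produces nothing new under `originLaw`. -/
theorem rows_relabel_iff_of_originLaw (Rows : DepthBoundA4.Design → Prop) (hsep : OriginSeparating) (hψ : ψ₀ ≫ ψ₀ = -(1 • 𝟙 E₀))
    (h : originLaw E₀ ψ₀ δ) (h' : originLaw E₀ ψ₀ (relabel δ r)) : Rows (relabel δ r).Dsh.shadow ↔ Rows δ.Dsh.shadow := by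
  rw [shadow_relabel_eq_of_originLaw hsep hψ h h']

/-- contrapositive — **a relabelling that MOVES one cell is NOT origin-pinned** (memo-213 (B4)'s `q = −1` conjugation flip of a cell included: it
moves that cell). -/
theorem not_originLaw_relabel_of_moves (hsep : OriginSeparating) (hψ : ψ₀ ≫ ψ₀ = -(1 • 𝟙 E₀)) (h : originLaw E₀ ψ₀ δ)
    (hmove : (∃ Z' : ↥r.D'.cfg.upper, (r.σP Z' : MCell) ≠ Z') ∨ ∃ Z' : ↥r.D'.cfg.lower, (r.σN Z' : MCell) ≠ Z') :
    ¬ originLaw E₀ ψ₀ (relabel δ r) := fun h' =>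
  have hs := hsep E₀ h.dim_eq_one ψ₀ hψ
  have hp' : (relabel δ r).PinnedTo (originModel E₀ h.dim_eq_one ψ₀) := (originLaw_iff h.dim_eq_one _).1 h'
  hmove.elim (fun ⟨Z', hZ'⟩ => hZ' (σP_fixed_of_pinned hs h.pinnedTo hp' Z')) fun ⟨Z', hZ'⟩ => hZ' (σN_fixed_of_pinned hs h.pinnedTo hp' Z')


end PinnedRelabel

/-! # PART D — HAZARD (f7) DECORATION REACH of the origin pin: the decoration-tolerant pin `decLaw`, the class of record `picZero`, the acceptance tests
(K1) ∕ (K2), the reach statements and the transports (memo-214 §D, idea-crit-hsem-3 g26; instance-of-record block by c5c8-1 g55)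

`originLaw` (v42.3) pins every letter ON THE NOSE to `letterBundle 𝒪(o) ψ₀ Z`.  A datum whose letters are these TWISTED by decorations `Q_Z` from a class
`𝒟 ∋ 𝒪` (instance of record `picZero`: HOMOGENEOUS rank-one modules on `S⁴` — e.g. the letters built from `θ = 𝒪(p)`, `p ≠ o`, i.e. v42.3's own
`letterLaw θ`, or a translate `t_x^* δ`) has the same cells, the same Néron–Severi classes and the same shadow, and is NOT origin-pinned as soon as one
twist does not cancel (`not_originLaw_of_twisted`).  So every instrument guarded by `originLaw` quantifies over UNDECORATED presentations only (ruling (P″)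
R19.894), while `stub_rung2a : Rung2a₀ 14` is law-free.  The decoration-tolerant pin `decLaw 𝒟` («letter ≅ origin letter of ITS OWN cell ⊗ a
decoration») passes the same acceptance tests: (K1) outright, (K2) modulo `DecSeparating`; `originLaw ⇒ decLaw 𝒟`, so the decorated-GUARD 2b₀ is the
STRONGER record and the decorated pin has the WIDER reach; the converse normalisation is the open `ReachModDec` (a `def`, never a theorem). -/

section Decoration


/-- **a DECORATION CLASS on the anchor**: a family of rank-one modules on `S⁴` containing `𝒪`, by which letters may be twisted without changing
their cells, classes or shadow (instance of record: `picZero`). A `structure` of hypotheses; nothing asserts a non-unit member exists. -/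
structure DecorationClass (E₀ : AbelianVariety ℂ) where
  /-- membership -/
  Dec : (pad4Anchor E₀).X.left.Modules → Prop
  hasRank_one : ∀ Q, Dec Q → HasRank Q 1
  unit : Dec (Modules.unitModule (pad4Anchor E₀).X.left)

/-- **the decoration class of record, `Pic⁰(S⁴)`**: rank one and HOMOGENEOUS (`t_x^* Q ≅ Q` for every rational point `x` — Mukai 1978 Def. 4.4,
tree `AbelianVarieties.IsHomogeneous`; for line bundles on a complex abelian variety this is `Pic⁰`, Mumford §8–§9); `𝒪` is homogeneous
(tree `AbelianVarieties.isHomogeneous_unit`). -/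
def picZero (E₀ : AbelianVariety ℂ) : DecorationClass E₀ where
  Dec Q := HasRank Q 1 ∧ AbelianVarieties.IsHomogeneous (pad4Anchor E₀) Q
  hasRank_one _ h := h.1
  unit := ⟨hasRank_unitModule, AbelianVarieties.isHomogeneous_unit (pad4Anchor E₀)⟩

variable (𝒟 : DecorationClass E₀)

/-- **DECORATED PINNING of a core to a letter model**: every letter is, up to isomorphism, the model's bundle OF ITS OWN CELL twisted by a
decoration of the class. -/
def DecPinnedTo (δ : SplitBlockCore₀ E₀ ψ₀) (ℓ : LetterModel E₀) : Prop :=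
  (∀ P ∈ δ.Dsh.cfg.upper, ∃ Q, 𝒟.Dec Q ∧ Nonempty (δ.termP.kit.L P ≅ tensorObj (ℓ.bundle P) Q)) ∧
    ∀ N ∈ δ.Dsh.cfg.lower, ∃ Q, 𝒟.Dec Q ∧ Nonempty (δ.termN.kit.L N ≅ tensorObj (ℓ.bundle N) Q)

variable {𝒟} {δ₀ : SplitBlockCore₀ E₀ ψ₀} {ℓ : LetterModel E₀}

/-- pinned ⇒ decorated-pinned (twist by `𝒪`: the right unitor `M ⊗ 𝒪 ≅ M`, tree `Modules.tensorUnitRightIso`). -/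
theorem decPinnedTo_of_pinnedTo (𝒟 : DecorationClass E₀) (h : δ₀.PinnedTo ℓ) : DecPinnedTo 𝒟 δ₀ ℓ :=
  ⟨fun P hP => ⟨_, 𝒟.unit, (h.1 P hP).map fun i => i ≪≫ (tensorUnitRightIso (ℓ.bundle P)).symm⟩,
    fun N hN => ⟨_, 𝒟.unit, (h.2 N hN).map fun i => i ≪≫ (tensorUnitRightIso (ℓ.bundle N)).symm⟩⟩

/-- decorated-pinned ⇒ exact rank one (R1: rank one ⊗ rank one, tree `hasRank_tensorObj_one`) … -/
theorem DecPinnedTo.lettersRankOne (h : DecPinnedTo 𝒟 δ₀ ℓ) : δ₀.LettersRankOne :=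
  ⟨fun P hP => by
      obtain ⟨Q, hQ, ⟨e⟩⟩ := h.1 P hP
      exact hasRank_of_iso e.symm (hasRank_tensorObj_one (ℓ.hasRank_one P) (𝒟.hasRank_one Q hQ)),
    fun N hN => by
      obtain ⟨Q, hQ, ⟨e⟩⟩ := h.2 N hN
      exact hasRank_of_iso e.symm (hasRank_tensorObj_one (ℓ.hasRank_one N) (𝒟.hasRank_one Q hQ))⟩

/-- … so **(K1) SURVIVES THE WIDENING**: no zero letter in a decorated-pinned core (`P`-side) … -/
theorem DecPinnedTo.not_isZero_P (h : DecPinnedTo 𝒟 δ₀ ℓ) {P : MCell} (hP : P ∈ δ₀.Dsh.cfg.upper) : ¬ IsZero (δ₀.termP.kit.L P) :=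
  h.lettersRankOne.not_isZero_P hP

/-- … (`N`-side) … -/
theorem DecPinnedTo.not_isZero_N (h : DecPinnedTo 𝒟 δ₀ ℓ) {N : MCell} (hN : N ∈ δ₀.Dsh.cfg.lower) : ¬ IsZero (δ₀.termN.kit.L N) :=
  h.lettersRankOne.not_isZero_N hN

/-- … and `Hazard.padZero` with one fresh cell is decorated-pinned to NO model, for NO decoration class. -/
theorem not_decPinnedTo_padZero (δ : SplitBlockDatum₀ E₀ ψ₀) (p : Padding δ.Dsh) (ℓ : LetterModel E₀) (𝒟 : DecorationClass E₀) {X : MCell}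
    (hX : X ∈ p.XP ∨ X ∈ p.XN) : ¬ DecPinnedTo 𝒟 (padZero δ p).toSplitBlockCore₀ ℓ := fun h =>
  hX.elim (fun hx => h.not_isZero_P (Finset.mem_union_right _ hx) (isZero_cutOffTerm_L δ.termP (Finset.disjoint_right.1 p.hP hx)))
    fun hx => h.not_isZero_N (Finset.mem_union_right _ hx) (isZero_cutOffTerm_L δ.termN (Finset.disjoint_right.1 p.hN hx))

/-- **the DECORATED SEPARATION obligation** — the typed price of the widening: twisted letters of distinct cells are not isomorphic,
`ℓ.bundle Z ⊗ Q ≅ ℓ.bundle Z' ⊗ Q'` with `Q, Q'` in the class ⇒ `Z = Z'`.  For `originModel` and `picZero` this is the SAME Néron–Severi Gram-matrix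
sentence as v42.3 `OriginSeparating`, read in `NS(S⁴) = Pic ∕ Pic⁰` (a `Pic⁰`-twist does not change the class). Documented TRUE; NOT proved here. -/
def DecSeparating (ℓ : LetterModel E₀) (𝒟 : DecorationClass E₀) : Prop :=
  ∀ (Z Z' : MCell) (Q Q' : (pad4Anchor E₀).X.left.Modules), 𝒟.Dec Q → 𝒟.Dec Q' →
    Nonempty (tensorObj (ℓ.bundle Z) Q ≅ tensorObj (ℓ.bundle Z') Q') → Z = Z'

/-- decorated separation implies plain separation (twist both sides by `𝒪`). -/
theorem DecSeparating.separating (h : DecSeparating ℓ 𝒟) : ℓ.Separating := fun Z Z' ⟨e⟩ =>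
  h Z Z' _ _ 𝒟.unit 𝒟.unit ⟨tensorUnitRightIso (ℓ.bundle Z) ≪≫ e ≪≫ (tensorUnitRightIso (ℓ.bundle Z')).symm⟩

/-- **(K2) SURVIVES THE WIDENING, modulo `DecSeparating`**: decorated-pinned letters name their cells (`P`-side) … -/
theorem DecPinnedTo.cell_eq_P {δ δ' : SplitBlockCore₀ E₀ ψ₀} (h : DecPinnedTo 𝒟 δ ℓ) (h' : DecPinnedTo 𝒟 δ' ℓ) (hs : DecSeparating ℓ 𝒟)
    {P P' : MCell} (hP : P ∈ δ.Dsh.cfg.upper) (hP' : P' ∈ δ'.Dsh.cfg.upper) (e : δ.termP.kit.L P ≅ δ'.termP.kit.L P') : P = P' := by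
  obtain ⟨Q, hQ, ⟨i⟩⟩ := h.1 P hP
  obtain ⟨Q', hQ', ⟨i'⟩⟩ := h'.1 P' hP'
  exact hs P P' Q Q' hQ hQ' ⟨i.symm ≪≫ e ≪≫ i'⟩

/-- … (`N`-side) … -/
theorem DecPinnedTo.cell_eq_N {δ δ' : SplitBlockCore₀ E₀ ψ₀} (h : DecPinnedTo 𝒟 δ ℓ) (h' : DecPinnedTo 𝒟 δ' ℓ) (hs : DecSeparating ℓ 𝒟)
    {N N' : MCell} (hN : N ∈ δ.Dsh.cfg.lower) (hN' : N' ∈ δ'.Dsh.cfg.lower) (e : δ.termN.kit.L N ≅ δ'.termN.kit.L N') : N = N' := by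
  obtain ⟨Q, hQ, ⟨i⟩⟩ := h.2 N hN
  obtain ⟨Q', hQ', ⟨i'⟩⟩ := h'.2 N' hN'
  exact hs N N' Q Q' hQ hQ' ⟨i.symm ≪≫ e ≪≫ i'⟩

variable {δ : SplitBlockDatum₀ E₀ ψ₀} {r : Relabelling δ.Dsh}

/-- … so a relabelling decorated-pinned before and after FIXES EVERY `P`-CELL … -/
theorem σP_fixed_of_decPinned (hs : DecSeparating ℓ 𝒟) (h : DecPinnedTo 𝒟 δ.toSplitBlockCore₀ ℓ)
    (h' : DecPinnedTo 𝒟 (relabel δ r).toSplitBlockCore₀ ℓ) (Z' : ↥r.D'.cfg.upper) : ((r.σP Z' : ↥δ.Dsh.cfg.upper) : MCell) = Z' :=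
  (DecPinnedTo.cell_eq_P h' h hs Z'.2 (r.σP Z').2 (eqToIso (relabel_termP_L δ r Z'))).symm

/-- … and EVERY `N`-CELL … -/
theorem σN_fixed_of_decPinned (hs : DecSeparating ℓ 𝒟) (h : DecPinnedTo 𝒟 δ.toSplitBlockCore₀ ℓ)
    (h' : DecPinnedTo 𝒟 (relabel δ r).toSplitBlockCore₀ ℓ) (Z' : ↥r.D'.cfg.lower) : ((r.σN Z' : ↥δ.Dsh.cfg.lower) : MCell) = Z' :=
  (DecPinnedTo.cell_eq_N h' h hs Z'.2 (r.σN Z').2 (eqToIso (relabel_termN_L δ r Z'))).symm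

/-- … and has THE SAME SHADOW: the relabelling critic produces nothing new under the WIDER law either. -/
theorem shadow_relabel_eq_of_decPinned (hs : DecSeparating ℓ 𝒟) (h : DecPinnedTo 𝒟 δ.toSplitBlockCore₀ ℓ)
    (h' : DecPinnedTo 𝒟 (relabel δ r).toSplitBlockCore₀ ℓ) : (relabel δ r).Dsh.shadow = δ.Dsh.shadow :=
  r.shadow_eq_of_fixed (σP_fixed_of_decPinned hs h h') (σN_fixed_of_decPinned hs h h')

/-- **THE REACH GAP (f7)**: a core carrying on one `P`-cell the model letter TWISTED by a decoration that does not cancel (`L ⊗ Q ≇ L` — on the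
intended letters, any `Q ∈ Pic⁰ ∖ {𝒪}`) is pinned to the model by NO family of isomorphisms, although its cells, classes and shadow are those of the
undecorated presentation.  (No such core is constructed; the theorem is the implication.) -/
theorem not_pinnedTo_of_twisted {P : MCell} (hP : P ∈ δ₀.Dsh.cfg.upper) {Q : (pad4Anchor E₀).X.left.Modules}
    (e : δ₀.termP.kit.L P ≅ tensorObj (ℓ.bundle P) Q) (hQ : IsEmpty (tensorObj (ℓ.bundle P) Q ≅ ℓ.bundle P)) : ¬ δ₀.PinnedTo ℓ :=
  fun h => (h.1 P hP).elim fun i => hQ.false (e.symm ≪≫ i)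

/-- at the law of record: a datum with one non-cancelling twisted origin letter FAILS `originLaw`. -/
theorem not_originLaw_of_twisted (h1 : E₀.dim = 1) {P : MCell} (hP : P ∈ δ.Dsh.cfg.upper) {Q : (pad4Anchor E₀).X.left.Modules}
    (e : δ.termP.kit.L P ≅ tensorObj ((originModel E₀ h1 ψ₀).bundle P) Q)
    (hQ : IsEmpty (tensorObj ((originModel E₀ h1 ψ₀).bundle P) Q ≅ (originModel E₀ h1 ψ₀).bundle P)) : ¬ originLaw E₀ ψ₀ δ :=
  fun h => not_pinnedTo_of_twisted hP e hQ ((originLaw_iff h1 δ).1 h)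

/-- … while it IS decorated-pinned as soon as all its letters are so twisted (definition) — stated for the record on the `P`-side-only shape:
a core whose every letter is an origin letter of its own cell twisted by a class member is `DecPinnedTo`. -/
theorem decPinnedTo_of_forall_twisted
    (hP : ∀ P ∈ δ₀.Dsh.cfg.upper, ∃ Q, 𝒟.Dec Q ∧ Nonempty (δ₀.termP.kit.L P ≅ tensorObj (ℓ.bundle P) Q))
    (hN : ∀ N ∈ δ₀.Dsh.cfg.lower, ∃ Q, 𝒟.Dec Q ∧ Nonempty (δ₀.termN.kit.L N ≅ tensorObj (ℓ.bundle N) Q)) : DecPinnedTo 𝒟 δ₀ ℓ :=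
  ⟨hP, hN⟩

/-- **a family of decoration classes, one per anchor** (what a `DatumLaw` quantifies over). -/
abbrev DecorationClasses := ∀ E₀ : AbelianVariety ℂ, DecorationClass E₀

/-- **THE DECORATION-TOLERANT PIN** (slot `Λ` of v42.1): the letters are, up to isomorphism, the origin letters OF THEIR OWN CELLS twisted by
decorations of the class. -/
def decLaw (𝒟 : DecorationClasses) : DatumLaw := fun E₀ ψ₀ δ => ∃ h1 : E₀.dim = 1, DecPinnedTo (𝒟 E₀) δ.toSplitBlockCore₀ (originModel E₀ h1 ψ₀)

/-- instance of record: origin letters modulo `Pic⁰(S⁴)`. -/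
def originPicZeroLaw : DatumLaw := decLaw picZero

/-- `originLaw ⇒ decLaw 𝒟` (every class contains `𝒪`). -/
theorem decLaw_of_originLaw (𝒟 : DecorationClasses) (h : originLaw E₀ ψ₀ δ) : decLaw 𝒟 E₀ ψ₀ δ :=
  ⟨h.dim_eq_one, decPinnedTo_of_pinnedTo (𝒟 E₀) h.pinnedTo⟩

/-- the decorated pin still implies the rank-one law (R1). -/
theorem rankOneLaw_of_decLaw (𝒟 : DecorationClasses) (h : decLaw 𝒟 E₀ ψ₀ δ) : rankOneLaw E₀ ψ₀ δ :=
  h.2.lettersRankOne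

/-- (K1) at the decorated law: `Hazard.padZero` with a fresh cell never satisfies `decLaw 𝒟`. -/
theorem not_decLaw_padZero (𝒟 : DecorationClasses) (δ : SplitBlockDatum₀ E₀ ψ₀) (p : Padding δ.Dsh) {X : MCell} (hX : X ∈ p.XP ∨ X ∈ p.XN) :
    ¬ decLaw 𝒟 E₀ ψ₀ (padZero δ p) :=
  fun ⟨h1, h⟩ => not_decPinnedTo_padZero δ p (originModel E₀ h1 ψ₀) (𝒟 E₀) hX h

/-- (K2) at the decorated law, modulo decorated separation of the origin letters: same shadow. -/
theorem shadow_relabel_eq_of_decLaw (𝒟 : DecorationClasses) (hsep : ∀ h1 : E₀.dim = 1, DecSeparating (originModel E₀ h1 ψ₀) (𝒟 E₀))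
    (h : decLaw 𝒟 E₀ ψ₀ δ) (h' : decLaw 𝒟 E₀ ψ₀ (relabel δ r)) : (relabel δ r).Dsh.shadow = δ.Dsh.shadow :=
  shadow_relabel_eq_of_decPinned (hsep h.1) h.2 h'.2

/-- **REACH, existence side**: whatever the origin pin reaches, the decorated pin reaches. -/
theorem rung2a₀Under_decLaw_of_originLaw (𝒟 : DecorationClasses) {h : ℤ} (H : Rung2a₀Under originLaw h) : Rung2a₀Under (decLaw 𝒟) h := by
  obtain ⟨E₀, ψ₀, h1, hψ, δ, hΛ, hpos, hpass, hrows⟩ := H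
  exact ⟨E₀, ψ₀, h1, hψ, δ, decLaw_of_originLaw 𝒟 hΛ, hpos, hpass, hrows⟩

/-- **REACH, kill side**: a 2b₀ record guarded by the decorated pin IMPLIES the one guarded by the origin pin (v42.1 `rung2b₀Under_antitone`) —
the wider guard is the STRONGER row statement, and the only one whose kill bears on decorated presentations. -/
theorem rung2b₀Under_originLaw_of_decLaw (𝒟 : DecorationClasses) {h : ℤ} {Rows : DepthBoundA4.Design → Prop}
    (H : Rung2b₀Under (decLaw 𝒟) h Rows) : Rung2b₀Under originLaw h Rows :=
  rung2b₀Under_antitone (fun _ _ _ hΛ => decLaw_of_originLaw 𝒟 hΛ) H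

/-- the same inside a σ-law of the shape of record `S ∧ pin ∧ K` (line #2's `lawSigma S := S ∧ originLaw ∧ KNI`): replacing the origin pin by the
decorated pin in the GUARD gives the stronger record, which implies the record of record. -/
theorem rung2b₀Under_sigma_originLaw_of_decLaw (𝒟 : DecorationClasses) (S K : DatumLaw) {h : ℤ} {Rows : DepthBoundA4.Design → Prop}
    (H : Rung2b₀Under (fun E₀ ψ₀ δ => S E₀ ψ₀ δ ∧ decLaw 𝒟 E₀ ψ₀ δ ∧ K E₀ ψ₀ δ) h Rows) :
    Rung2b₀Under (fun E₀ ψ₀ δ => S E₀ ψ₀ δ ∧ originLaw E₀ ψ₀ δ ∧ K E₀ ψ₀ δ) h Rows :=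
  rung2b₀Under_antitone (fun _ _ _ hΛ => ⟨hΛ.1, decLaw_of_originLaw 𝒟 hΛ.2.1, hΛ.2.2⟩) H

/-- the same for the two-conjunct guard of (W‴) R19.892 — `Alpha1RowPinned W := Rung2b₀Under (StaticAlongTW W ∧ originLaw) 14 RuleD`: the
decorated-guard α1 row implies the origin-guard α1 row. -/
theorem rung2b₀Under_and_originLaw_of_decLaw (𝒟 : DecorationClasses) (S : DatumLaw) {h : ℤ} {Rows : DepthBoundA4.Design → Prop}
    (H : Rung2b₀Under (fun E₀ ψ₀ δ => S E₀ ψ₀ δ ∧ decLaw 𝒟 E₀ ψ₀ δ) h Rows) :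
    Rung2b₀Under (fun E₀ ψ₀ δ => S E₀ ψ₀ δ ∧ originLaw E₀ ψ₀ δ) h Rows :=
  rung2b₀Under_antitone (fun _ _ _ hΛ => ⟨hΛ.1, decLaw_of_originLaw 𝒟 hΛ.2⟩) H

/-- **THE OPEN NORMALISATION modulo decorations** (stated, NOT asserted, NOT proved): every decorated-pinned rung is re-presentable origin-pinned.
For a uniform TRANSLATE `t_x^* δ` it would be translating back (if `Passes` is translation-invariant as typed); for letters built from `θ = 𝒪(p)`,
`p ≠ o`, or cell-dependent twists, no re-presentation with the same block is known to the critic.  Until this is proved, a kill under `originLaw`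
does not bear on decorated presentations, and `stub_rung2a : Rung2a₀ 14` is law-free. -/
def ReachModDec (𝒟 : DecorationClasses) (h : ℤ) : Prop := Rung2a₀Under (decLaw 𝒟) h → Rung2a₀Under originLaw h

/-- under the normalisation, the two guarded rungs agree. -/
theorem rung2a₀Under_decLaw_iff (𝒟 : DecorationClasses) {h : ℤ} (hN : ReachModDec 𝒟 h) : Rung2a₀Under (decLaw 𝒟) h ↔ Rung2a₀Under originLaw h :=
  ⟨hN, rung2a₀Under_decLaw_of_originLaw 𝒟⟩


/-! ### the instance of record, by name (R19.894 (R-a): `originPicZeroLaw := decLaw picZero`) -/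

/-- `originPicZeroLaw` unfolded: the letters are the origin letters of their own cells twisted by `Pic⁰(S⁴)`. -/
theorem originPicZeroLaw_iff (δ' : SplitBlockDatum₀ E₀ ψ₀) :
    originPicZeroLaw E₀ ψ₀ δ' ↔ ∃ h1 : E₀.dim = 1, DecPinnedTo (picZero E₀) δ'.toSplitBlockCore₀ (originModel E₀ h1 ψ₀) :=
  Iff.rfl

theorem originPicZeroLaw.dim_eq_one (h : originPicZeroLaw E₀ ψ₀ δ) : E₀.dim = 1 := h.1

/-- **MONOTONE: the origin pin implies the `Pic⁰`-decorated pin** (twist by `𝒪`). -/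
theorem originPicZeroLaw_of_originLaw (h : originLaw E₀ ψ₀ δ) : originPicZeroLaw E₀ ψ₀ δ :=
  decLaw_of_originLaw picZero h

/-- (R1) survives: the `Pic⁰`-decorated pin implies the exact-rank-one law. -/
theorem rankOneLaw_of_originPicZeroLaw (h : originPicZeroLaw E₀ ψ₀ δ) : rankOneLaw E₀ ψ₀ δ :=
  rankOneLaw_of_decLaw picZero h

/-- **(K1) at the instance of record, OUTRIGHT**: a zero-letter padding with one fresh cell is never `Pic⁰`-decorated-pinned. -/
theorem not_originPicZeroLaw_padZero (δ' : SplitBlockDatum₀ E₀ ψ₀) (p : Padding δ'.Dsh) {X : MCell} (hX : X ∈ p.XP ∨ X ∈ p.XN) :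
    ¬ originPicZeroLaw E₀ ψ₀ (padZero δ' p) :=
  not_decLaw_padZero picZero δ' p hX

/-- **THE TYPED OBLIGATION AT THE DECORATED LAW OF RECORD** (the price of (K2) after the widening): on a one-dimensional `E₀` with CM generator `ψ₀`
(`ψ₀² = −1`), the origin letters are separated MODULO `Pic⁰(S⁴)` — `letterBundle 𝒪(o) ψ₀ Z ⊗ Q ≅ letterBundle 𝒪(o) ψ₀ Z' ⊗ Q'` with `Q, Q'` homogeneous
of rank one forces `Z = Z'`.  The same Néron–Severi Gram-matrix sentence as v42.3's `OriginSeparating`, read in `NS(S⁴) = Pic ∕ Pic⁰`; documented TRUE,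
NOT proved in this file. -/
def OriginDecSeparating : Prop :=
  ∀ (E₀ : AbelianVariety ℂ) (h1 : E₀.dim = 1) (ψ₀ : E₀ ⟶ E₀), ψ₀ ≫ ψ₀ = -(1 • 𝟙 E₀) → DecSeparating (originModel E₀ h1 ψ₀) (picZero E₀)

/-- the decorated obligation implies v42.3's plain one. -/
theorem OriginDecSeparating.originSeparating (h : OriginDecSeparating) : OriginSeparating :=
  fun E₀ h1 ψ₀ hψ => (h E₀ h1 ψ₀ hψ).separating

/-- **(K2) at the instance of record**, modulo `OriginDecSeparating`: a `Pic⁰`-pinned relabelling of a `Pic⁰`-pinned datum has THE SAME SHADOW … -/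
theorem shadow_relabel_eq_of_originPicZeroLaw (hsep : OriginDecSeparating) (hψ : ψ₀ ≫ ψ₀ = -(1 • 𝟙 E₀)) (h : originPicZeroLaw E₀ ψ₀ δ)
    (h' : originPicZeroLaw E₀ ψ₀ (relabel δ r)) : (relabel δ r).Dsh.shadow = δ.Dsh.shadow :=
  shadow_relabel_eq_of_decLaw picZero (fun h1 => hsep E₀ h1 ψ₀ hψ) h h'

/-- … hence NO row predicate tells it from the datum. -/
theorem rows_relabel_iff_of_originPicZeroLaw (Rows : DepthBoundA4.Design → Prop) (hsep : OriginDecSeparating) (hψ : ψ₀ ≫ ψ₀ = -(1 • 𝟙 E₀))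
    (h : originPicZeroLaw E₀ ψ₀ δ) (h' : originPicZeroLaw E₀ ψ₀ (relabel δ r)) : Rows (relabel δ r).Dsh.shadow ↔ Rows δ.Dsh.shadow := by
  rw [shadow_relabel_eq_of_originPicZeroLaw hsep hψ h h']

/-- … and a relabelling that MOVES one cell is not `Pic⁰`-pinned. -/
theorem not_originPicZeroLaw_relabel_of_moves (hsep : OriginDecSeparating) (hψ : ψ₀ ≫ ψ₀ = -(1 • 𝟙 E₀)) (h : originPicZeroLaw E₀ ψ₀ δ)
    (hmove : (∃ Z' : ↥r.D'.cfg.upper, (r.σP Z' : MCell) ≠ Z') ∨ ∃ Z' : ↥r.D'.cfg.lower, (r.σN Z' : MCell) ≠ Z') :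
    ¬ originPicZeroLaw E₀ ψ₀ (relabel δ r) := fun h' =>
  have hs : DecSeparating (originModel E₀ h.1 ψ₀) (picZero E₀) := hsep E₀ h.1 ψ₀ hψ
  hmove.elim (fun ⟨Z', hZ'⟩ => hZ' (σP_fixed_of_decPinned hs h.2 h'.2 Z')) fun ⟨Z', hZ'⟩ => hZ' (σN_fixed_of_decPinned hs h.2 h'.2 Z')

/-- **RUNG 2a₀ PINNED TO THE ORIGIN LETTERS MODULO `Pic⁰`** — v42.1's `Rung2a₀Under` at the decorated law of record. -/
def Rung2a₀PicZero (h : ℤ) : Prop := Rung2a₀Under originPicZeroLaw h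

theorem rung2a₀_of_rung2a₀PicZero {h : ℤ} (H : Rung2a₀PicZero h) : Rung2a₀ h := Rung2a₀Under.rung2a₀ H

/-- REACH, existence side, at the instance of record: whatever the origin pin reaches, the `Pic⁰`-decorated pin reaches. -/
theorem rung2a₀PicZero_of_rung2a₀Origin {h : ℤ} (H : Rung2a₀Origin h) : Rung2a₀PicZero h :=
  rung2a₀Under_decLaw_of_originLaw picZero H

theorem rung2a₀Under_rankOneLaw_of_rung2a₀PicZero {h : ℤ} (H : Rung2a₀PicZero h) : Rung2a₀Under rankOneLaw h := by
  obtain ⟨E₀, ψ₀, h1, hψ, δ', hΛ, hpos, hpass, hrows⟩ := H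
  exact ⟨E₀, ψ₀, h1, hψ, δ', rankOneLaw_of_originPicZeroLaw hΛ, hpos, hpass, hrows⟩

/-- REACH, kill side, at the instance of record: a 2b₀ record guarded by `originPicZeroLaw` implies the one guarded by `originLaw`. -/
theorem rung2b₀Under_originLaw_of_originPicZeroLaw {h : ℤ} {Rows : DepthBoundA4.Design → Prop} (H : Rung2b₀Under originPicZeroLaw h Rows) :
    Rung2b₀Under originLaw h Rows :=
  rung2b₀Under_originLaw_of_decLaw picZero H

/-- the same inside a guard of shape `S ∧ pin ∧ K` (line #2's `lawSigma S := S ∧ originLaw ∧ lawKNI`, `lawNatural S := S ∧ originLaw ∧ lawFloor`, literally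
these lambdas): the `Pic⁰`-guarded record implies the record of record. -/
theorem rung2b₀Under_sigma_originLaw_of_originPicZeroLaw (S K : DatumLaw) {h : ℤ} {Rows : DepthBoundA4.Design → Prop}
    (H : Rung2b₀Under (fun E₀ ψ₀ δ => S E₀ ψ₀ δ ∧ originPicZeroLaw E₀ ψ₀ δ ∧ K E₀ ψ₀ δ) h Rows) :
    Rung2b₀Under (fun E₀ ψ₀ δ => S E₀ ψ₀ δ ∧ originLaw E₀ ψ₀ δ ∧ K E₀ ψ₀ δ) h Rows :=
  rung2b₀Under_sigma_originLaw_of_decLaw picZero S K H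

/-- the same for the two-conjunct guard `S ∧ pin` (line #2's `lawPinned S := S ∧ originLaw`; (W‴) R19.892's `Alpha1RowPinned W`). -/
theorem rung2b₀Under_and_originLaw_of_originPicZeroLaw (S : DatumLaw) {h : ℤ} {Rows : DepthBoundA4.Design → Prop}
    (H : Rung2b₀Under (fun E₀ ψ₀ δ => S E₀ ψ₀ δ ∧ originPicZeroLaw E₀ ψ₀ δ) h Rows) :
    Rung2b₀Under (fun E₀ ψ₀ δ => S E₀ ψ₀ δ ∧ originLaw E₀ ψ₀ δ) h Rows :=
  rung2b₀Under_and_originLaw_of_decLaw picZero S H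

/-- and for the bare pins: whatever 2a₀ presentation the `Pic⁰`-guarded 2b₀ kills, it kills in particular every origin-pinned one. -/
theorem rung2a₀PicZero_rows {h : ℤ} {Rows : DepthBoundA4.Design → Prop} (H2b : Rung2b₀Under originPicZeroLaw h Rows) (H2a : Rung2a₀PicZero h) :
    ∃ (E₀ : AbelianVariety ℂ) (ψ₀ : E₀ ⟶ E₀) (δ' : SplitBlockDatum₀ E₀ ψ₀), originPicZeroLaw E₀ ψ₀ δ' ∧ Rows δ'.Dsh.shadow := by
  obtain ⟨E₀, ψ₀, h1, hψ, δ', hΛ, hpos, hpass, hrows⟩ := H2a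
  exact ⟨E₀, ψ₀, δ', hΛ, H2b E₀ ψ₀ h1 hψ δ' hΛ hpos hpass hrows⟩

end Decoration

/-! ## Audit
`DecorationClass`, `picZero`, `DecPinnedTo`, `DecSeparating`, `OriginDecSeparating`, `DecorationClasses`, `decLaw`, `originPicZeroLaw`, `Rung2a₀PicZero`,
`ReachModDec` are `Prop`s ∕ shapes ∕ a bundle of hypotheses, stated, never asserted; `picZero.unit` is the tree's `hasRank_unitModule` + `isHomogeneous_unit`;
PART H constructs paddings ∕ relabellings OF A GIVEN datum (no datum is given); every theorem is an implication or an unfolding over them and tree v42.1 ∕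
v42.3.  Nothing here proves or refutes `stub_rung2a`, `Rung2a₀ 14`, `Rung2a₀Origin 14`, `Rung2a₀PicZero 14`, any row stub, 18881, 18880, 30548, 19780,
27388, № 4, H2, HC_AV, HC_CM or HC; typed ≠ proved; registered ≠ closed. -/
theorem audit_nothing_decided_picZeroPin : True := trivial

end SplitBlock

end Summit.HodgeConjecture.HodgeConjecture.Cruxes.BlochSeedDiscOne.SeedChecker

end
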